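import Literature.NumberTheory.PAdicHodge.FontaineDpst
import Literature.NumberTheory.GaloisRepresentations.OrdinaryRegular
import Literature.NumberTheory.GaloisRepresentations.LocalClassFieldTheory
import HarnessLib

/-!
# Gee–Geraghty 2012, Lemma 3.1.4 (3): an ordinary representation of REGULAR weight whose diagonal
# characters are crystalline is crystalline

Topic `NumberTheory/PAdicHodge` (pattern of `FontaineDpst.lean`: statements about THE pinned datum
`fontainePst F ℓ hℓ` / `fontainePstAdicCompletion v ℓ hv`).  Vocabulary: `FramedGaloisRep`, `FramedRep.conj`,
`FramedRep.IsUpperTriangular`, `FramedRep.diagEntry`, `LabelledWeight`, `LabelledWeight.IsDominant`,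
`ordinaryWeightUnit`, `LocalArtinData(.IsCanonical)`, `WeilGroup.inertia`, `WeilGroup.toAbsGalois` (`OrdinaryRegular`,
`LocalClassFieldTheory`), `PstWeilDeligneData.IsCrystallineFramed`, `fontainePst` (`FontaineDpst`).
Requested by the line `thorne-minimal-lift` of crux `stmt-Langlands-13757` (blueprint fact F7 of its stub
`stub_pointAutomorphic`: at `u ∣ 3` of the soluble base change both the point `ρ_y` of the ordinary family and its
companion are B-ordinary with diagonal characters EXACTLY algebraic on inertia and gap-`≥ 2` weights, and Thorne 2017
Thm 5.1 (iv)(b) — tree `Thorne2017.automorphyLifting_unitary_ordinaryMinimal` — wants them crystalline).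

T. Gee, D. Geraghty, *Companion forms for unitary and symplectic groups*, Duke Math. J. 161 (2012) 247–303
(held text arXiv:1001.2044, §3.1.2 pp. 6–7, read 2026-08-17).  Notation (p. 6): `ℤⁿ₊` = non-increasing `n`-tuples;
`λ ∈ (ℤⁿ₊)^{Hom(M,K)}` is REGULAR "if for each `j = 1, …, n-1` there exists `τ : M ↪ K` with `λ_{τ,j} > λ_{τ,j+1}`";
Def. 3.1.2: `χ^λ_j : I_M → 𝒪ˣ`, `σ ↦ ε(σ)^{-(j-1)} ∏_{τ} τ(Art_M⁻¹(σ))^{-λ_{τ,n-j+1}}` (`Art_M` normalised to take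
uniformisers to geometric Frobenii; "`χ^λ_j` can also be thought of as the restriction to `I_M` of any crystalline
character whose Hodge–Tate weight with respect to `τ` is `(j-1)+λ_{τ,n-j+1}`", `HT(ε) = -1`); p. 7: `ρ : G_M → GL_n(B)` is
ORDINARY OF WEIGHT `λ` if it is conjugate to an upper triangular representation with diagonal characters `ψ_1, …, ψ_n`,
`ψ_j` agreeing with `χ^λ_j` on an open subgroup of `I_M`.

> **Lemma 3.1.4.** Suppose that `E` is an algebraic extension of `K` and `ρ : G_M → GL_n(E)` is ordinary of weight
> `λ`. Let `ψ_1, …, ψ_n : G_M → Eˣ` be as above. Then (1) `ρ` is potentially semistable. (2) If each `ψ_j` is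
> crystalline (which occurs if and only if `ψ_j` agrees with `χ^λ_j` on all of `I_M`), then `ρ` is semistable.
> (3) If each `ψ_j` is crystalline and `λ` is regular, then `ρ` is crystalline.
> *Proof.* Part 2 follows from Proposition 1.28(2) of [Nekovář] and part 1 follows from part 2. Part 3 follows from
> Proposition 1.26 of [Nekovář] and the formulae in Proposition 1.24 of [Nekovář].

## What is vendored: part (3), over `E = ℚ̄_ℓ`, for THE pinned datum

NAMED FACT (D-0014) `GeeGeraghty2012.crystalline_of_ordinary_regular`: for a characteristic-`0` non-archimedean
local field `F` of residue characteristic `ℓ` (`hℓ : |ℓ|_F < 1`), the CANONICAL local Artin datum `art`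
(`LocalArtinData.IsCanonical`), `ρ : Γ_F →ₜ* GL_n(ℚ̄_ℓ)` and a labelled weight `λ` (`wt : LabelledWeight F ℚ̄_ℓ n`):
IF `λ` is dominant and regular, and `ρ` is conjugate to an upper triangular representation whose `i`-th diagonal entry
is, on ALL of the inertia subgroup of the Weil group, the algebraic character
`ordinaryWeightUnit λ i ∘ Art_F = ∏_τ τ(Art_F⁻¹ ·)^{-(λ_{τ,n-i} + i)}` (`i : Fin n`, 0-indexed; = `χ^λ_{i+1}` granted the
class-field-theoretic identity `ε ∘ Art_F = ∏_τ τ` on `𝒪_Fˣ`, which is how the tree's `ordinaryWeightUnit` /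
`IsOrdinaryOfLabelledWeight` render `χ^λ_j`, see the module docstring of `OrdinaryRegular.lean` and
`CrystallineOrdinary.lean`) — i.e. `ρ` is ordinary of weight `λ` with every `ψ_j = χ^λ_j` on all of `I_F`, the hypothesis
of (2)–(3) — THEN `ρ` is crystalline relative to THE `p`-adic Hodge datum `fontainePst F ℓ hℓ`
(`PstWeilDeligneData.IsCrystallineFramed`: de Rham, Weil–Deligne representation unramified with `N = 0`).
The corollary `crystalline_of_ordinary_regular_at` restates it at a place `v ∣ ℓ` of a number field for the summit's
datum `fontainePstAdicCompletion v ℓ hv` (definitionally `fontainePst` of the completion).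
-- TODO(general form): parts (1) (potentially semistable) and (2) (semistable) — the tree has no semistability
-- predicate for the pinned datum; coefficients in a finite local `E`-algebra `B`.

## Discharge status (provefact unit, 2026-08-17): a corollary of `FontaineDatumExists`

The fact concerns the Weil–Deligne half `IsWeilDeligneOf` of THE pinned datum, which is pinned by specification
only (Hilbert's `ε` over the data on `B_dR(F)` with the clauses `IsFontaineDatum`; module docstring of
`FontaineDpst`).  UNCONDITIONALLY it is not certifiable: the accepted twin theorem
`Summit.Langlands.Langlands.Theorems.EmptyWeightCore.Negative.exists_twin_fontainePst_isCrystallineFramed_imp_isLocallyUnramified`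
exhibits a datum with the pin's two unconditional invariants (canonical `ℚ_ℓ`-structure, period ring `B_dR`) and
all structure axioms for which every crystalline representation of rank `≥ 2` is unramified, whereas an ordinary
representation of regular weight is infinitely ramified in rank `≥ 2`; so no argument uniform over the `ε`-range
proves `crystalline_of_ordinary_regular`, and a genuine proof needs the construction D2 (`B_st`, `D_pst`,
`WD ∘ D_pst`) — i.e. the discharge of `FontaineDatumExists` — followed by Nekovář's argument.  Following the
Upgrade path of `FontaineDpst` ("literature seats may ADD clauses to `IsFontaineDatum` that are theorems for the
genuine datum"), Gee–Geraghty's Lemma 3.1.4 (3) — verbatim the hypotheses below, for a general datum `𝔇` — is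
clause (F14) `IsFontaineDatum.isCrystallineFramed_of_ordinary_regular` of the specification (2026-08-17), and
the fact is its instance for THE datum under `FontaineDatumExists`:
`crystalline_of_ordinary_regular_of_fontaineDatumExists` below (one line from
`FontaineDatumExists.isCrystallineFramed_of_ordinary_regular`, whose statement is this fact's body).  The
remaining debt is `FontaineDatumExists` itself (whose honest discharge verifies (F14) for the constructed
`D_st`: debt re-keyed, not created); `theorem crystalline_of_ordinary_regular_holds` is then
`crystalline_of_ordinary_regular_of_fontaineDatumExists FontaineDatumExists_holds`.

## References

* [GeeGeraghty2012] T. Gee, D. Geraghty, Duke Math. J. 161 (2012), §3.1.2, Def. 3.1.2, Lemma 3.1.4.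
* [Nekovar1993HeightPairings] J. Nekovář, *On p-adic height pairings*, Sém. Théorie des Nombres Paris 1990–91,
  Progr. Math. 108 (1993), Props. 1.24, 1.26, 1.28 (cited by the source for the proof; not held).
* [PerrinRiou1994Ordinaires] B. Perrin-Riou, *Représentations p-adiques ordinaires*, Astérisque 223 (1994) (context).
-/

noncomputable section

open scoped MatrixGroups NumberField
open NumberField IsDedekindDomain Field ValuativeRel
open Literature.NumberTheory.GaloisRepresentations

namespace Literature.NumberTheory.PAdicHodge

namespace GeeGeraghty2012

/-- **Gee–Geraghty 2012, Lemma 3.1.4 (3) — ordinary of regular weight with crystalline diagonal characters ⇒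
crystalline**, NAMED FACT, for THE pinned datum.  For every characteristic-`0` non-archimedean local field `F` with
`|ℓ|_F < 1`, the canonical local Artin datum `art`, `ρ : Γ_F →ₜ* GL_n(ℚ̄_ℓ)` and labelled weight `λ`: if `λ` is dominant
(`λ_{τ,1} ≥ ⋯ ≥ λ_{τ,n}`) and regular (for each consecutive pair of rows some label `τ` with strict inequality), and
after a change of frame `ρ` is upper triangular with `i`-th diagonal entry EQUAL to
`∏_τ τ(Art_F⁻¹ w)^{-(λ_{τ,n-i} + i)}` for EVERY `w` in the inertia subgroup of the Weil group (each `ψ_j` crystalline,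
`ψ_j = χ^λ_j` on all of `I_F`), then `ρ` is crystalline relative to `fontainePst F ℓ hℓ`.
[cite: GeeGeraghty2012, Lemma 3.1.4 (3) with Def. 3.1.2 and §3.1.2 (regular weights)] -/
def crystalline_of_ordinary_regular : Prop :=
  ∀ (F : Type) [Field F] [ValuativeRel F] [TopologicalSpace F] [IsNonarchimedeanLocalField F] [CharZero F]
    (ℓ : ℕ) [Fact ℓ.Prime] (hℓ : valuation F ℓ < 1) (n : ℕ)
    (art : LocalArtinData F), art.IsCanonical →
    ∀ (ρ : FramedGaloisRep F (PadicAlgCl ℓ) n) (wt : LabelledWeight F (PadicAlgCl ℓ) n),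
      -- `λ ∈ (ℤⁿ₊)^{Hom(F, ℚ̄_ℓ)}`
      wt.IsDominant →
      -- `λ` regular: for each `j = 1, …, n-1` some `τ` with `λ_{τ,j} > λ_{τ,j+1}`
      (∀ i j : Fin n, (i : ℕ) + 1 = j → ∃ τ : HodgeTateLabel F (PadicAlgCl ℓ), wt τ j < wt τ i) →
      -- ordinary of weight `λ` with `ψ_j = χ^λ_j` on ALL of inertia (each `ψ_j` crystalline)
      (∃ g : GL (Fin n) (PadicAlgCl ℓ), FramedRep.IsUpperTriangular (ρ.conj g) ∧
        ∀ w ∈ WeilGroup.inertia F, ∀ i : Fin n,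
          FramedRep.diagEntry (ρ.conj g) i (WeilGroup.toAbsGalois F w) =
            (ordinaryWeightUnit wt i (art.artin w) : PadicAlgCl ℓ)) →
      -- conclusion: crystalline for THE datum
      (fontainePst F ℓ hℓ).IsCrystallineFramed ρ

/-- **The same at a place `v ∣ ℓ` of a number field**, for the summit's datum `fontainePstAdicCompletion v ℓ hv`
(which is `fontainePst (K_v) ℓ _` by definition): under `crystalline_of_ordinary_regular`, a `ρ_v : Γ_{K_v} → GL_n(ℚ̄_ℓ)`
that is ordinary of a dominant regular weight with crystalline diagonal characters (canonical Artin datum of `K_v`) is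
crystalline at `v`. [cite: GeeGeraghty2012, Lemma 3.1.4 (3)] -/
theorem crystalline_of_ordinary_regular_at (h : crystalline_of_ordinary_regular)
    {K : Type} [Field K] [NumberField K] {ℓ : ℕ} [Fact ℓ.Prime]
    (v : HeightOneSpectrum (𝓞 K)) (hv : ((ℓ : ℕ) : 𝓞 K) ∈ v.asIdeal) {n : ℕ}
    (art : LocalArtinData (v.adicCompletion K)) (hart : art.IsCanonical)
    (ρv : FramedGaloisRep (v.adicCompletion K) (PadicAlgCl ℓ) n)
    (wt : LabelledWeight (v.adicCompletion K) (PadicAlgCl ℓ) n) (hdom : wt.IsDominant)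
    (hreg : ∀ i j : Fin n, (i : ℕ) + 1 = j → ∃ τ : HodgeTateLabel (v.adicCompletion K) (PadicAlgCl ℓ), wt τ j < wt τ i)
    (hord : ∃ g : GL (Fin n) (PadicAlgCl ℓ), FramedRep.IsUpperTriangular (ρv.conj g) ∧
        ∀ w ∈ WeilGroup.inertia (v.adicCompletion K), ∀ i : Fin n,
          FramedRep.diagEntry (ρv.conj g) i (WeilGroup.toAbsGalois (v.adicCompletion K) w) =
            (ordinaryWeightUnit wt i (art.artin w) : PadicAlgCl ℓ)) :
    (fontainePstAdicCompletion v ℓ hv).IsCrystallineFramed ρv := by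
  haveI := LocalField.charZero_adicCompletion v
  exact h (v.adicCompletion K) ℓ (LocalField.valuation_adicCompletion_natCast_lt_one v ℓ hv) n art hart ρv wt
    hdom hreg hord

/-- **Gee–Geraghty 2012, Lemma 3.1.4 (3) for THE datum follows from Fontaine's existence theorem** — the
discharge of `crystalline_of_ordinary_regular` MODULO the T0 build debt `FontaineDatumExists` of the pin: the
lemma is clause (F14) `IsFontaineDatum.isCrystallineFramed_of_ordinary_regular` of Fontaine's characterising
clauses (for a general datum `𝔇`, binders verbatim the ones above), and under `FontaineDatumExists` THE datum
`fontainePst F ℓ hℓ` satisfies every clause (`isFontaineDatum_fontainePst`), whence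
`FontaineDatumExists.isCrystallineFramed_of_ordinary_regular`, whose statement is this fact's body.  See the
module docstring ("Discharge status") for why no unconditional proof exists short of the construction of
`WD ∘ D_pst`. [cite: GeeGeraghty2012, Def. 3.1.2 and Lemma 3.1.4 (3)] -/
theorem crystalline_of_ordinary_regular_of_fontaineDatumExists (h : FontaineDatumExists) :
    crystalline_of_ordinary_regular :=
  fun F _ _ _ _ _ ℓ _ hℓ n art hart ρ wt hdom hreg hord =>
    h.isCrystallineFramed_of_ordinary_regular F ℓ hℓ n art hart ρ wt hdom hreg hord

/-- … and so does its number-field form `crystalline_of_ordinary_regular_at` (the shape consumed at the places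
`u ∣ ℓ` by line `thorne-minimal-lift` of crux `stmt-Langlands-13757`): under `FontaineDatumExists`, a
`ρ_v : Γ_{K_v} →ₜ* GL_n(ℚ̄_ℓ)` ordinary of a dominant regular labelled weight with diagonal characters `χ^λ_j` on
all of inertia (canonical Artin datum of `K_v`) is crystalline for `fontainePstAdicCompletion v ℓ hv`.
[cite: GeeGeraghty2012, Lemma 3.1.4 (3)] -/
theorem crystalline_of_ordinary_regular_at_of_fontaineDatumExists (h : FontaineDatumExists)
    {K : Type} [Field K] [NumberField K] {ℓ : ℕ} [Fact ℓ.Prime]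
    (v : HeightOneSpectrum (𝓞 K)) (hv : ((ℓ : ℕ) : 𝓞 K) ∈ v.asIdeal) {n : ℕ}
    (art : LocalArtinData (v.adicCompletion K)) (hart : art.IsCanonical)
    (ρv : FramedGaloisRep (v.adicCompletion K) (PadicAlgCl ℓ) n)
    (wt : LabelledWeight (v.adicCompletion K) (PadicAlgCl ℓ) n) (hdom : wt.IsDominant)
    (hreg : ∀ i j : Fin n, (i : ℕ) + 1 = j → ∃ τ : HodgeTateLabel (v.adicCompletion K) (PadicAlgCl ℓ), wt τ j < wt τ i)
    (hord : ∃ g : GL (Fin n) (PadicAlgCl ℓ), FramedRep.IsUpperTriangular (ρv.conj g) ∧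
        ∀ w ∈ WeilGroup.inertia (v.adicCompletion K), ∀ i : Fin n,
          FramedRep.diagEntry (ρv.conj g) i (WeilGroup.toAbsGalois (v.adicCompletion K) w) =
            (ordinaryWeightUnit wt i (art.artin w) : PadicAlgCl ℓ)) :
    (fontainePstAdicCompletion v ℓ hv).IsCrystallineFramed ρv :=
  crystalline_of_ordinary_regular_at (crystalline_of_ordinary_regular_of_fontaineDatumExists h) v hv art hart
    ρv wt hdom hreg hord

end GeeGeraghty2012

end Literature.NumberTheory.PAdicHodge

end
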